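import Summits.SmoothPoincare4.SmoothPoincare4.Theorems.ConvexBisectionAcyclicBisectionExistsOrseamFrame
import Summits.SmoothPoincare4.SmoothPoincare4.Theorems.ConvexBisectionAcyclicBisectionExistsPageRotationField
import HarnessLib

/-!
# Dual handles, ORSEAM: the page frames `(T, iT, n)` of `∂ Base g` are positively oriented
(sub-goal ORSEAM of stub `stub_T3_dualPresentation` (T3), line `modp-braid-orbits` r12, crux
`ConvexBisection.AcyclicBisectionExists`, item stmt-SmoothPoincare4-10508; wave 5, lead c5, worker X4;
registered sub-goal `helper_det4_pageFrame_pos`)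

Sequel of `…OrseamFrame.lean` (`det4` as the determinant form).  The COUPLING between the page-twisting sign
of the dual presentation (ST4's global sign `s₀`, a PAGE-determinant sign) and the ORSEAM frame sign (a
`det4 (∇rho, ·, ·, ·)` sign) rests on one fact about the model `Base g ⊂ ℂ²` (S2's convention,
`LefschetzSteinOpenBook.lean`: "`(K', iK', n)` is positive for the boundary orientation of the COMPLEX
orientation"): at a flat page point `q` of `∂ Base g` (`‖x‖² < 4`, `w ≠ 0`), for every non-zero page tangent `T`
(`dΦ_q(T) = 0`), the frame `(T, iT, n(q))` — page tangent, its complex rotate, horizontal normal — satisfies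
**`det4 (∇rho (q), T, iT, n(q)) > 0`** (`det4_pageFrame_pos`).  Ingredients:

* §1 `det4` in coordinates (`det4_expand`, Laplace expansion) and its polynomial consequences: linear
  recombination of the last three slots multiplies by the `3 × 3` determinant (`det4_lincomb₃`), the
  upper-triangular identity `det4 (N, T, αT + βU, aT + bU + γM) = βγ det4 (N, T, U, M)` (`det4_triangular`), and
  **`det4 (T, iT, N, iN) = ‖x_T y_N − y_T x_N‖²`** (`det4_cplx_pair`: a complex frame is non-negatively oriented).
* §2 the model at a flat point: `∇rho = 2 w (ā, b̄)` (`gradient_rho_of_flat`), `n = (1/‖dΦ‖²) · i (w (ā, b̄))`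
  (`horizNormal_eq_smul_cplxJ`), tangency of `T`, `iT`, `n` (`fderiv_rho_*`; `dPhi_horizNormal` of `…PageRotationField.lean`), and the positivity.

Everything is proved; no named facts, no `sorry`.

## References
* R. İ. Baykur, *Kähler decomposition of 4-manifolds*, AGT 6 (2006), §2.3. [Baykur2006]
* P. Griffiths, J. Harris, *Principles of Algebraic Geometry* (1978), Ch. 0 §2 (complex orientation). [GriffithsHarris1978]
-/

noncomputable section

-- the prescribed namespace `Summit.<P>.<Sub>.…` duplicates `SmoothPoincare4` (P = Sub)
set_option linter.dupNamespace false

open scoped Manifold ContDiff Topology RealInnerProductSpace ComplexConjugate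

namespace Summit.SmoothPoincare4.SmoothPoincare4.Theorems.AcyclicBisectionExists.ModpBraidOrbits

open Set Function Metric Module Complex
open Literature.Topology.FourManifolds Literature.Topology.FourManifolds.HandleAttachingMap
  Literature.Topology.FourManifolds.LefschetzBase Literature.Geometry.Symplectic

/-! ## §1 `det4` in coordinates -/

section Det4Coord

/-- **Laplace expansion of `det4` along the first row.** [folklore] -/
theorem det4_expand (a b c d : EuclideanSpace ℝ (Fin 4)) :
    det4 a b c d =
      a 0 * (b 1 * (c 2 * d 3 - c 3 * d 2) - b 2 * (c 1 * d 3 - c 3 * d 1) + b 3 * (c 1 * d 2 - c 2 * d 1))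
      - a 1 * (b 0 * (c 2 * d 3 - c 3 * d 2) - b 2 * (c 0 * d 3 - c 3 * d 0) + b 3 * (c 0 * d 2 - c 2 * d 0))
      + a 2 * (b 0 * (c 1 * d 3 - c 3 * d 1) - b 1 * (c 0 * d 3 - c 3 * d 0) + b 3 * (c 0 * d 1 - c 1 * d 0))
      - a 3 * (b 0 * (c 1 * d 2 - c 2 * d 1) - b 1 * (c 0 * d 2 - c 2 * d 0) + b 2 * (c 0 * d 1 - c 1 * d 0)) := by
  unfold det4
  rw [Matrix.det_succ_row_zero]
  simp [Fin.sum_univ_succ, Matrix.det_fin_three, Matrix.submatrix_apply, Fin.succAbove, Matrix.of_apply]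
  ring

/-- **Recombining the last three slots multiplies by the `3 × 3` determinant.** [folklore] -/
theorem det4_lincomb₃ (N T U M : EuclideanSpace ℝ (Fin 4)) (x₁ x₂ x₃ y₁ y₂ y₃ z₁ z₂ z₃ : ℝ) :
    det4 N (x₁ • T + x₂ • U + x₃ • M) (y₁ • T + y₂ • U + y₃ • M) (z₁ • T + z₂ • U + z₃ • M) =
      (x₁ * (y₂ * z₃ - y₃ * z₂) - x₂ * (y₁ * z₃ - y₃ * z₁) + x₃ * (y₁ * z₂ - y₂ * z₁)) * det4 N T U M := by
  rw [det4_expand, det4_expand]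
  simp only [PiLp.add_apply, PiLp.smul_apply, smul_eq_mul]
  ring

/-- **The upper-triangular identity**: `det4 (N, T, αT + βU, aT + bU + γM) = βγ · det4 (N, T, U, M)`. [folklore] -/
theorem det4_triangular (N T U M : EuclideanSpace ℝ (Fin 4)) (α β a b γ : ℝ) :
    det4 N T (α • T + β • U) (a • T + b • U + γ • M) = β * γ * det4 N T U M := by
  rw [det4_expand, det4_expand]
  simp only [PiLp.add_apply, PiLp.smul_apply, smul_eq_mul]
  ring

/-- The coordinates of `i v`. [folklore] -/
theorem cplxJ_coord (v : EuclideanSpace ℝ (Fin 4)) :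
    cplxJ v 0 = -v 1 ∧ cplxJ v 1 = v 0 ∧ cplxJ v 2 = -v 3 ∧ cplxJ v 3 = v 2 := by
  simp [cplxJ, LefschetzBase.mk, cx, cy]

/-- **A complex frame is non-negatively oriented**: `det4 (T, iT, N, iN) = ‖x_T y_N − y_T x_N‖²` (the real
determinant of the complex matrix with columns `T`, `N` is the squared modulus of its complex determinant).
[cite: GriffithsHarris1978, Ch. 0 §2] -/
theorem det4_cplx_pair (T N : EuclideanSpace ℝ (Fin 4)) :
    det4 T (cplxJ T) N (cplxJ N) = ‖cx T * cy N - cy T * cx N‖ ^ 2 := by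
  obtain ⟨h0, h1, h2, h3⟩ := cplxJ_coord T
  obtain ⟨k0, k1, k2, k3⟩ := cplxJ_coord N
  rw [det4_expand, h0, h1, h2, h3, k0, k1, k2, k3, Complex.sq_norm, Complex.normSq_apply]
  simp [cx, cy]
  ring

/-- Moving the third vector to the front of a complex pair frame: `det4 (N, T, iT, iN) = det4 (T, iT, N, iN)`
(an even permutation). [folklore] -/
theorem det4_rotate_cplx (T N : EuclideanSpace ℝ (Fin 4)) :
    det4 N T (cplxJ T) (cplxJ N) = det4 T (cplxJ T) N (cplxJ N) := by
  rw [det4_expand, det4_expand]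
  ring

/-- `det4` is homogeneous in its last slot. [folklore] -/
theorem det4_smul_last (a b c d : EuclideanSpace ℝ (Fin 4)) (r : ℝ) :
    det4 a b c (r • d) = r * det4 a b c d := by
  rw [det4_expand, det4_expand]
  simp only [PiLp.smul_apply, smul_eq_mul]
  ring

end Det4Coord

/-! ## §2 The model at a flat point: `∇rho`, `n`, tangency, positivity -/

section Model

variable {g : ℕ}

/-- Pairing with the vector `w (ā, b̄)`: `⟪V, w (ā, b̄)⟫ = Re (w̄ · dΦ(V))`. [folklore] -/
theorem inner_gradVec (q V : EuclideanSpace ℝ (Fin 4)) :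
    ⟪V, LefschetzBase.mk (w g q * conj (dPhiX g q)) (w g q * conj (dPhiY q))⟫ =
      (conj (w g q) * (dPhiX g q * cx V + dPhiY q * cy V)).re := by
  rw [inner_eq_re_herm, cx_mk, cy_mk]
  simp only [map_mul, Complex.conj_conj, Complex.mul_re, Complex.add_re, Complex.add_im, Complex.mul_im,
    Complex.conj_re, Complex.conj_im]
  ring

/-- **The gradient of `rho` in the flat region**: `∇rho (q) = 2 w (ā, b̄)` for `‖x(q)‖² < 4`
(`d rho_q(V) = 2 Re (w̄ dΦ_q(V))`, `fderiv_rho_apply_of_flat`). [folklore] -/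
theorem gradient_rho_of_flat {q : EuclideanSpace ℝ (Fin 4)} (hflat : ‖cx q‖ ^ 2 < 4) :
    gradient (rho g) q = (2 : ℝ) • LefschetzBase.mk (w g q * conj (dPhiX g q)) (w g q * conj (dPhiY q)) := by
  apply ext_inner_right ℝ
  intro V
  rw [inner_gradient_eq_fderiv, fderiv_rho_apply_of_flat hflat, real_inner_smul_left, real_inner_comm,
    inner_gradVec]

/-- `‖dΦ_q‖² = ‖a‖² + ‖b‖² > 0` off the origin. [folklore] -/
theorem dPhi_normSq_pos {q : EuclideanSpace ℝ (Fin 4)} (hq : q ≠ 0) :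
    0 < ‖dPhiX g q‖ ^ 2 + ‖dPhiY q‖ ^ 2 := by
  rcases dPhiX_ne_zero_or (g := g) hq with h | h
  · have := norm_pos_iff.2 h; positivity
  · have := norm_pos_iff.2 h; positivity

/-- **The horizontal normal is a positive multiple of `i · w (ā, b̄)`**: `n(q) = (1/‖dΦ_q‖²) · i (w (ā, b̄))`.
[folklore] -/
theorem horizNormal_eq_smul_cplxJ {q : EuclideanSpace ℝ (Fin 4)} (hq : q ≠ 0) :
    horizNormal g q = (1 / (‖dPhiX g q‖ ^ 2 + ‖dPhiY q‖ ^ 2)) •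
      cplxJ (LefschetzBase.mk (w g q * conj (dPhiX g q)) (w g q * conj (dPhiY q))) := by
  have hD := (dPhi_normSq_pos (g := g) hq).ne'
  have hDc : ((‖dPhiX g q‖ : ℂ) ^ 2 + (‖dPhiY q‖ : ℂ) ^ 2) ≠ 0 := by exact_mod_cast hD
  apply ext_cx_cy
  · rw [cx_horizNormal, cx_smul, cx_cplxJ, cx_mk]
    push_cast
    field_simp
  · rw [cy_horizNormal, cy_smul, cy_cplxJ, cy_mk]
    push_cast
    field_simp

/-- A page tangent is tangent to the boundary (flat region): `dΦ_q(T) = 0 ⇒ d rho_q(T) = 0`. [folklore] -/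
theorem fderiv_rho_pageTangent {q T : EuclideanSpace ℝ (Fin 4)} (hflat : ‖cx q‖ ^ 2 < 4)
    (hT : dPhiX g q * cx T + dPhiY q * cy T = 0) : fderiv ℝ (rho g) q T = 0 := by
  rw [fderiv_rho_apply_of_flat hflat, hT, mul_zero, Complex.zero_re, mul_zero]

/-- The complex rotate of a page tangent is a page tangent: `dΦ_q(iT) = i dΦ_q(T) = 0`. [folklore] -/
theorem dPhi_cplxJ_pageTangent {q T : EuclideanSpace ℝ (Fin 4)}
    (hT : dPhiX g q * cx T + dPhiY q * cy T = 0) :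
    dPhiX g q * cx (cplxJ T) + dPhiY q * cy (cplxJ T) = 0 := by
  rw [cx_cplxJ, cy_cplxJ]
  linear_combination Complex.I * hT

/-- The horizontal normal is tangent to the boundary (flat region): `d rho_q(n) = 2 Re (w̄ · i w) = 0`. [folklore] -/
theorem fderiv_rho_horizNormal {q : EuclideanSpace ℝ (Fin 4)} (hq : q ≠ 0) (hflat : ‖cx q‖ ^ 2 < 4) :
    fderiv ℝ (rho g) q (horizNormal g q) = 0 := by
  rw [fderiv_rho_apply_of_flat hflat, dPhi_horizNormal hq,
    show conj (w g q) * (Complex.I * w g q) = Complex.I * (w g q * conj (w g q)) by ring, Complex.mul_conj]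
  simp [Complex.mul_re, Complex.I_re, Complex.I_im]

/-- A non-zero page tangent is complex-independent of `(ā, b̄)`: `x_T b̄ − y_T ā ≠ 0`. [folklore] -/
theorem pageTangent_cross_ne_zero {q T : EuclideanSpace ℝ (Fin 4)} (hq : q ≠ 0) (hT0 : T ≠ 0)
    (hT : dPhiX g q * cx T + dPhiY q * cy T = 0) :
    cx T * conj (dPhiY q) - cy T * conj (dPhiX g q) ≠ 0 := by
  intro h
  set a := dPhiX g q with ha
  set b := dPhiY q with hb
  have hD : a * conj a + b * conj b ≠ 0 := by
    rw [Complex.mul_conj, Complex.mul_conj, ← Complex.ofReal_add, Complex.ofReal_ne_zero,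
      Complex.normSq_eq_norm_sq, Complex.normSq_eq_norm_sq]
    exact (dPhi_normSq_pos (g := g) hq).ne'
  have hx : cx T * (a * conj a + b * conj b) = 0 := by
    linear_combination conj a * hT + b * h
  have hy : cy T * (a * conj a + b * conj b) = 0 := by
    linear_combination conj b * hT - a * h
  have hx0 : cx T = 0 := (mul_eq_zero.1 hx).resolve_right hD
  have hy0 : cy T = 0 := (mul_eq_zero.1 hy).resolve_right hD
  apply hT0
  have : T = LefschetzBase.mk 0 0 := by rw [← mk_cx_cy T, hx0, hy0]
  rw [this]
  apply ext_cx_cy <;> simp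

/-- **The page frames are positively oriented**: at a flat point `q ≠ 0` with `w(q) ≠ 0`, for every non-zero
page tangent `T` (`dΦ_q(T) = 0`): `det4 (∇rho (q), T, iT, n(q)) > 0` — the triple `(T, iT, n)` is a POSITIVE
frame of `∂ Base g` for the boundary orientation of the complex orientation (S2's convention). [cite: Baykur2006, §2.3] -/
theorem det4_pageFrame_pos {q T : EuclideanSpace ℝ (Fin 4)} (hq : q ≠ 0) (hflat : ‖cx q‖ ^ 2 < 4)
    (hw : w g q ≠ 0) (hT0 : T ≠ 0) (hT : dPhiX g q * cx T + dPhiY q * cy T = 0) :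
    0 < det4 (gradient (rho g) q) T (cplxJ T) (horizNormal g q) := by
  set U := LefschetzBase.mk (w g q * conj (dPhiX g q)) (w g q * conj (dPhiY q)) with hU
  have hD := dPhi_normSq_pos (g := g) hq
  rw [gradient_rho_of_flat hflat, horizNormal_eq_smul_cplxJ hq, det4_smul_left, det4_smul_last,
    det4_rotate_cplx, det4_cplx_pair]
  have hcross : cx T * cy U - cy T * cx U ≠ 0 := by
    rw [hU, cx_mk, cy_mk]
    have h1 := pageTangent_cross_ne_zero hq hT0 hT
    have : cx T * (w g q * conj (dPhiY q)) - cy T * (w g q * conj (dPhiX g q)) =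
        w g q * (cx T * conj (dPhiY q) - cy T * conj (dPhiX g q)) := by ring
    rw [this]
    exact mul_ne_zero hw h1
  have h2 : 0 < ‖cx T * cy U - cy T * cx U‖ ^ 2 := pow_pos (norm_pos_iff.2 hcross) 2
  have h3 : 0 < 1 / (‖dPhiX g q‖ ^ 2 + ‖dPhiY q‖ ^ 2) := div_pos one_pos hD
  positivity

end Model

/-! ## §3 The registered package -/

/-- **Sub-goal `helper_det4_pageFrame_pos` of stub `stub_T3_dualPresentation`** (T3 ▸ ORSEAM coupling; wave 5,
lead c5, worker X4): **the page frames `(T, iT, n)` of `∂ Base g` are positively oriented for the boundary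
orientation of the complex orientation** — at a flat point `q ≠ 0` (`‖x(q)‖² < 4`) with `w(q) ≠ 0`, for every
non-zero page tangent `T` (`dΦ_q(T) = 0`): `0 < det4 (∇rho (q), T, iT, n(q))`.  This is the convention behind
`pageTwisting = -1` ⇔ positive Lefschetz handle (S2, `LefschetzSteinOpenBook.lean`) and the first half of the
coupling "orientation character of a fibred map = sign of its page determinant". [cite: Baykur2006, §2.3] -/
theorem helper_det4_pageFrame_pos : ∀ (g : ℕ) (q T : EuclideanSpace ℝ (Fin 4)), q ≠ 0 → ‖Literature.Topology.FourManifolds.LefschetzBase.cx q‖ ^ 2 < 4 → Literature.Topology.FourManifolds.LefschetzBase.w g q ≠ 0 → T ≠ 0 → Literature.Topology.FourManifolds.LefschetzBase.dPhiX g q * Literature.Topology.FourManifolds.LefschetzBase.cx T + Literature.Topology.FourManifolds.LefschetzBase.dPhiY q * Literature.Topology.FourManifolds.LefschetzBase.cy T = 0 → 0 < Literature.Geometry.Symplectic.det4 (gradient (Literature.Topology.FourManifolds.LefschetzBase.rho g) q) T (Literature.Topology.FourManifolds.LefschetzBase.cplxJ T) (Literature.Topology.FourManifolds.LefschetzBase.horizNormal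 g q) :=
  fun _ _ _ hq hflat hw hT0 hT => det4_pageFrame_pos hq hflat hw hT0 hT

end Summit.SmoothPoincare4.SmoothPoincare4.Theorems.AcyclicBisectionExists.ModpBraidOrbits

end
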